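import Literature.AnabelianGeometry.AbsoluteAnabelian.LogShellVolumes
import Mathlib.NumberTheory.Padics.ProperSpace
import HarnessLib

/-!
# [AbsTopIII] Prop 5.7 (i)(c) / Cor 5.10 (i)(ii): the schemata `LogVolumeCompatible log`, `LogShellFiniteVolume L`,
# `LogVolumesLogCompatible K log hasArc` (FACT-LIST F-0134 / F-0160 / F-0161) have REFUTABLE universal closures

S. Mochizuki, *Topics in absolute anabelian geometry III*, J. Math. Sci. Univ. Tokyo 22 (2015)
[MochizukiAbsTopIII2015], Prop 5.7 (i)(c) p. 138, Cor 5.10 (i), (ii) p. 147 (manuscript pages).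

Negative knowledge recorded next to `LocalVolumesNonarchimedean.lean` / `LogShellVolumes.lean`
(abc-iut-L4-t3; FACT-LIST rows **F-0134**, **F-0160**, **F-0161**, class `preparatory`, cone-inside, status
`model-witness`), PROOF-ONLY (no definitions, no instances), abc-iut cell seat abc-iut-w5-d182.

The three rows are PARAMETRISED predicates over data that the typing does not pin to the `p`-adic logarithm:

* `LogVolumeCompatible (log : K → K)` — Prop 5.7 (i)(c) "`μ^log(A) = μ^log(log(A))`" for an ARBITRARY map `log`;
* `LogShellFiniteVolume (L : PadicLogOnUnits K)` — Cor 5.10 (i) "the log-shell `ℐ = (p*)⁻¹·log(𝒪^×)` is compact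
  open" for an ARBITRARY hypothesis structure `L`, which records `log` only on the principal units `1 + p*·𝒪`
  (junk values on the rest of `𝒪^×` are unconstrained);
* `LogVolumesLogCompatible K log hasArc` — Cor 5.10 (ii), the conjunction of the first row over a family of places.

All three HOLD at the standard model of the genuine logarithm (`logVolumeCompatible_unitLog`,
`Literature.IUT.LogThetaLattice.logShellFiniteVolume_ofUnitLog`, `logVolumesLogCompatible_unitLog`; abc-iut-L4-t8,
abc-iut-L6-d2, abc-iut-L3-t11), which is the form consumers bind. This file supplies the kernel objects saying that
the UNIVERSAL closures are false, at EVERY proper ultrametric field (not only at some exotic one):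

* `not_logVolumeCompatible_mul` — for every `ϖ ∈ K^×` with `‖ϖ‖ < 1` the map `x ↦ ϖ·x` is injective, maps
  `A := 1 + ϖ𝒪 ∈ M(k)` (inside `𝒪^×`) onto `ϖ + ϖ²𝒪 ∈ M(k)`, and scales the volume by `[𝒪 : ϖ𝒪]⁻¹ ≤ 1/2`;
  hence `exists_not_logVolumeCompatible` (F-0134) and `exists_not_logVolumesLogCompatible` (F-0161);
* `exists_not_logShellFiniteVolume` — for every such `K` there is a `PadicLogOnUnits K` (`p* := ϖ²`,
  `log := x ↦ x − 1` on `1 + ϖ²𝒪`, junk value `1` elsewhere) whose log-shell is `𝒪 ∪ {ϖ⁻²}`, NOT open (F-0160);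
* the fully quantified closures are refuted at `K = ℚ_[2]` (`not_forall_logVolumeCompatible`,
  `not_forall_logShellFiniteVolume`, `not_forall_logVolumesLogCompatible`).

So each row is admissible ONLY in its instance form at the genuine logarithm (FACT-LIST class «universal-closure
REFUTED; instance model-witnessed», like F-0162 / `MonoAnalyticLogShellVolumeNegative.lean`). Classical local-field
bookkeeping; nothing here bears on the disputed [IUTchIII] Cor. 3.12 or takes a side; refuted is never a fact.
-/

noncomputable section

open Metric Set
open scoped Pointwise NNReal

namespace Literature.AnabelianGeometry.AbsoluteAnabelian

open Literature.NumberTheory.GaloisRepresentations.Ultrametric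

section Ultrametric

variable {K : Type*} [NontriviallyNormedField K] [IsUltrametricDist K]

/-- In an ultrametric field, `1 + ϖ𝒪 ⊆ 𝒪^×` for `‖ϖ‖ < 1`: `‖x - 1‖ ≤ ‖ϖ‖ < 1 ⇒ ‖x‖ = 1`.
[cite: MochizukiAbsTopIII2015, Def 5.4 (iii) p. 126] -/
theorem norm_eq_one_of_mem_closedBall_one {r : ℝ} (hr : r < 1) {x : K} (hx : x ∈ closedBall (1 : K) r) :
    ‖x‖ = 1 := by
  rw [mem_closedBall, dist_eq_norm] at hx
  have hlt : ‖x - 1‖ < ‖(1 : K)‖ := by rw [norm_one]; exact hx.trans_lt hr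
  have := IsUltrametricDist.norm_add_eq_max_of_norm_ne_norm (ne_of_lt hlt)
  rwa [sub_add_cancel, max_eq_right hlt.le, norm_one] at this

/-- `1 + ϖ𝒪 = closedBall 1 ‖ϖ‖ ∈ M(k)` (nonempty, compact, open) for `ϖ ≠ 0`.
[cite: MochizukiAbsTopIII2015, Prop 5.7 (i) p. 137] -/
theorem closedBall_one_mem_compactOpens [ProperSpace K] {ϖ : K} (hϖ : ϖ ≠ 0) :
    closedBall (1 : K) ‖ϖ‖ ∈ compactOpens K :=
  ⟨⟨1, mem_closedBall_self (norm_nonneg _)⟩, isCompact_closedBall _ _,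
    IsUltrametricDist.isOpen_closedBall _ (norm_ne_zero_iff.mpr hϖ)⟩

omit [IsUltrametricDist K] in
/-- the image of `A` under `x ↦ ϖ·x` is the dilate `ϖ • A`. [folklore] -/
private theorem image_mul_left_eq_smul (ϖ : Kˣ) (A : Set K) : (fun x : K => (ϖ : K) * x) '' A = ϖ • A := by
  ext y
  simp only [mem_image, mem_smul_set, Units.smul_def, smul_eq_mul]

/-- **F-0134, universal closure false at every field:** for `ϖ ∈ K^×` with `‖ϖ‖ < 1`, multiplication by `ϖ` is
NOT log-volume compatible — it is injective on `A := 1 + ϖ𝒪 ∈ M(k)`, `A ⊆ 𝒪^×`, `ϖ·A ∈ M(k)`, but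
`μ^log(ϖ·A) = μ^log(A) + log [𝒪 : ϖ𝒪]⁻¹ < μ^log(A)`. [cite: MochizukiAbsTopIII2015, Prop 5.7 (i)(c) p. 138] -/
theorem not_logVolumeCompatible_mul [ProperSpace K] [MeasurableSpace K] [BorelSpace K]
    (ϖ : Kˣ) (hϖ : ‖(ϖ : K)‖ < 1) :
    ¬ LogVolumeCompatible (fun x : K => (ϖ : K) * x) := by
  intro h
  have hA : closedBall (1 : K) ‖(ϖ : K)‖ ∈ compactOpens K := closedBall_one_mem_compactOpens ϖ.ne_zero
  have hsub : closedBall (1 : K) ‖(ϖ : K)‖ ⊆ {x : K | ‖x‖ = 1} := fun x hx =>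
    norm_eq_one_of_mem_closedBall_one hϖ hx
  have hinj : InjOn (fun x : K => (ϖ : K) * x) (closedBall (1 : K) ‖(ϖ : K)‖) :=
    fun x _ y _ hxy => mul_left_cancel₀ ϖ.ne_zero hxy
  have himg : (fun x : K => (ϖ : K) * x) '' closedBall (1 : K) ‖(ϖ : K)‖ ∈ compactOpens K := by
    rw [image_mul_left_eq_smul]; exact units_smul_mem_compactOpens ϖ hA
  have key := h _ hA hsub hinj himg
  rw [image_mul_left_eq_smul, localLogVolume_units_smul ϖ hA] at key
  -- `unitLogVolume K ϖ = log [𝒪 : ϖ𝒪]⁻¹ < 0`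
  have hq : (2 : ℝ) ≤ (resIndex ϖ : ℝ) := by exact_mod_cast two_le_resIndex hϖ
  have hunit : unitLogVolume K ϖ < 0 := by
    rw [unitLogVolume, unitVolume_eq_distribHaarChar, distribHaarChar_uniformizer_real hϖ.le]
    exact Real.log_neg (by positivity) (inv_lt_one_of_one_lt₀ (by linarith))
  linarith

/-- hence, at every proper ultrametric field, SOME map violates F-0134 (`‖ϖ‖ < 1` exists since the norm is
nontrivial). [cite: MochizukiAbsTopIII2015, Prop 5.7 (i)(c) p. 138] -/
theorem exists_not_logVolumeCompatible [ProperSpace K] [MeasurableSpace K] [BorelSpace K] :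
    ∃ log : K → K, ¬ LogVolumeCompatible log := by
  obtain ⟨x, hx0, hx1⟩ := NormedField.exists_norm_lt_one K
  exact ⟨_, not_logVolumeCompatible_mul (Units.mk0 x (norm_pos_iff.mp hx0)) hx1⟩

/-- In an ultrametric field, `‖1 + y‖ = 1` whenever `‖y‖ < 1`. [folklore] -/
private theorem norm_one_add_eq_one {y : K} (hy : ‖y‖ < 1) : ‖1 + y‖ = 1 := by
  have hne : ‖(1 : K)‖ ≠ ‖y‖ := by rw [norm_one]; exact (ne_of_lt hy).symm
  rw [IsUltrametricDist.norm_add_eq_max_of_norm_ne_norm hne, norm_one, max_eq_left hy.le]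

/-- **F-0160, universal closure false at every field:** for `ϖ ∈ K^×` with `‖ϖ‖ < 1` the hypothesis structure
`PadicLogOnUnits K` with `p* := ϖ²`, `log := x ↦ x − 1` on `1 + ϖ²𝒪` (a bijection onto `ϖ²𝒪`, as the structure
demands) and junk value `1` on the rest of `𝒪^× ⊇ {1 + ϖ}` has log-shell `ℐ = ϖ⁻²·(ϖ²𝒪 ∪ {1}) = 𝒪 ∪ {ϖ⁻²}`, which is
not open at the isolated point `ϖ⁻²`; so `ℐ ∉ M(k)`. [cite: MochizukiAbsTopIII2015, Cor 5.10 (i) p. 147] -/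
theorem exists_not_logShellFiniteVolume_of_norm_lt_one (ϖ : Kˣ) (hϖ : ‖(ϖ : K)‖ < 1) :
    ∃ L : PadicLogOnUnits K, L.pstar = (ϖ : K) ^ 2 ∧ ¬ LogShellFiniteVolume L := by
  classical
  have hϖ0 : (ϖ : K) ≠ 0 := ϖ.ne_zero
  have hϖpos : 0 < ‖(ϖ : K)‖ := norm_pos_iff.mpr hϖ0
  set r : ℝ := ‖(ϖ : K) ^ 2‖ with hr
  have hr' : r = ‖(ϖ : K)‖ ^ 2 := by rw [hr, norm_pow]
  have hrpos : 0 < r := by rw [hr']; positivity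
  have hr1 : r < 1 := by rw [hr']; nlinarith
  have hrϖ : r < ‖(ϖ : K)‖ := by rw [hr']; nlinarith
  -- the junk logarithm
  let lg : K → K := fun x => if x ∈ closedBall (1 : K) r then x - 1 else 1
  have lg_of_mem : ∀ x ∈ closedBall (1 : K) r, lg x = x - 1 := fun x hx => if_pos hx
  have lg_of_not_mem : ∀ x ∉ closedBall (1 : K) r, lg x = 1 := fun x hx => if_neg hx
  have himage : lg '' closedBall (1 : K) r = closedBall (0 : K) r := by
    ext y
    simp only [mem_image, mem_closedBall, dist_eq_norm, sub_zero]
    constructor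
    · rintro ⟨x, hx, rfl⟩
      rw [lg_of_mem x (by rwa [mem_closedBall, dist_eq_norm])]; exact hx
    · intro hy
      refine ⟨y + 1, by simpa using hy, ?_⟩
      rw [lg_of_mem (y + 1) (by simpa [mem_closedBall, dist_eq_norm] using hy)]; simp
  have hinj : InjOn lg (closedBall (1 : K) r) := by
    intro x hx y hy hxy
    rw [lg_of_mem x hx, lg_of_mem y hy] at hxy
    exact sub_left_injective hxy
  let L : PadicLogOnUnits K :=
    { log := lg, pstar := (ϖ : K) ^ 2, pstar_ne_zero := pow_ne_zero 2 hϖ0,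
      norm_pstar_lt_one := hr1, image_principalUnits := himage, injOn_principalUnits := hinj }
  refine ⟨L, rfl, ?_⟩
  -- the unit `1 + ϖ` lies outside `1 + ϖ²𝒪`, so `1 ∈ ℐ* = log(𝒪^×)`
  have hu_sphere : (1 : K) + ϖ ∈ sphere (0 : K) 1 := by
    rw [mem_sphere, dist_zero_right]; exact norm_one_add_eq_one hϖ
  have hu_not : (1 : K) + ϖ ∉ closedBall (1 : K) r := by
    rw [mem_closedBall, dist_eq_norm, add_sub_cancel_left, not_le]; exact hrϖ
  have h1pre : (1 : K) ∈ preLogShell L := ⟨1 + ϖ, hu_sphere, lg_of_not_mem _ hu_not⟩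
  -- every element of `ℐ*` is in `ϖ²𝒪` or equals `1`
  have hpre : ∀ y ∈ preLogShell L, ‖y‖ ≤ r ∨ y = 1 := by
    rintro y ⟨x, -, rfl⟩
    by_cases hx : x ∈ closedBall (1 : K) r
    · left
      have : lg x ∈ closedBall (0 : K) r := by rw [← himage]; exact mem_image_of_mem _ hx
      rwa [mem_closedBall, dist_zero_right] at this
    · right; exact lg_of_not_mem x hx
  -- `ϖ⁻² ∈ ℐ`
  have hpt : ((ϖ : K) ^ 2)⁻¹ ∈ logShell L := by
    refine mem_smul_set.mpr ⟨1, h1pre, ?_⟩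
    simp [L]
  -- `ℐ` is not open at `ϖ⁻²`
  intro hfin
  have hopen : IsOpen (logShell L) := hfin.2.2
  obtain ⟨ε, hε, hball⟩ := Metric.isOpen_iff.mp hopen _ hpt
  obtain ⟨z, hz0, hzε⟩ := NormedField.exists_norm_lt K (lt_min hε one_pos)
  have hzε' : ‖z‖ < ε := hzε.trans_le (min_le_left _ _)
  have hz1 : ‖z‖ < 1 := hzε.trans_le (min_le_right _ _)
  have hmem : ((ϖ : K) ^ 2)⁻¹ + z ∈ logShell L :=
    hball (by rw [mem_ball, dist_eq_norm, add_sub_cancel_left]; exact hzε')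
  obtain ⟨y, hy, hyz⟩ := mem_smul_set.mp hmem
  have hp0 : (ϖ : K) ^ 2 ≠ 0 := pow_ne_zero 2 hϖ0
  -- `y = p*·(p*⁻¹ + z) = 1 + p*·z`
  have hy_eq : y = 1 + (ϖ : K) ^ 2 * z := by
    have : y = (ϖ : K) ^ 2 * (((ϖ : K) ^ 2)⁻¹ + z) := by
      rw [← hyz]; simp [L]
    rw [this, mul_add, mul_inv_cancel₀ hp0]
  have hsmall : ‖(ϖ : K) ^ 2 * z‖ < 1 := by
    rw [norm_mul]; exact mul_lt_one_of_nonneg_of_lt_one_left (norm_nonneg _) hr1 hz1.le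
  rcases hpre y hy with hyr | hy1
  · -- `‖1 + p*·z‖ = 1 ≤ r < 1`: absurd
    rw [hy_eq, norm_one_add_eq_one hsmall] at hyr
    exact absurd hyr (not_le.mpr hr1)
  · -- `p*·z = 0`: absurd since `z ≠ 0`
    rw [hy_eq, add_eq_left, mul_eq_zero] at hy1
    rcases hy1 with h | h
    · exact hp0 h
    · exact (norm_pos_iff.mp hz0) h

/-- hence, at every proper ultrametric field, SOME `PadicLogOnUnits` structure violates F-0160.
[cite: MochizukiAbsTopIII2015, Cor 5.10 (i) p. 147] -/
theorem exists_not_logShellFiniteVolume : ∃ L : PadicLogOnUnits K, ¬ LogShellFiniteVolume L := by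
  obtain ⟨x, hx0, hx1⟩ := NormedField.exists_norm_lt_one K
  obtain ⟨L, -, hL⟩ := exists_not_logShellFiniteVolume_of_norm_lt_one (Units.mk0 x (norm_pos_iff.mp hx0)) hx1
  exact ⟨L, hL⟩

end Ultrametric

section OnePlace

variable {K : Type} [NontriviallyNormedField K] [IsUltrametricDist K] [ProperSpace K]
  [MeasurableSpace K] [BorelSpace K]

/-- **F-0161, universal closure false at every field** (in `Type`, as the family predicate is typed): over the
one-place family `v ↦ K` with `log_v := (ϖ·)`, `LogVolumesLogCompatible` fails — its nonarchimedean conjunct is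
F-0134 — whatever the archimedean flag. [cite: MochizukiAbsTopIII2015, Cor 5.10 (ii) p. 147] -/
theorem exists_not_logVolumesLogCompatible (hasArc : Prop) :
    ∃ log : Unit → K → K, ¬ LogVolumesLogCompatible (fun _ : Unit => K) log hasArc := by
  obtain ⟨log, hlog⟩ := exists_not_logVolumeCompatible (K := K)
  exact ⟨fun _ => log, fun h => hlog (h.1 ())⟩

end OnePlace

/-! ## The fully quantified closures, refuted at `ℚ_[2]` -/

/-- **FACT-LIST F-0134, universal closure REFUTED** (witness `K = ℚ_[2]`, `log := (2·)`).
[cite: MochizukiAbsTopIII2015, Prop 5.7 (i)(c) p. 138] -/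
theorem not_forall_logVolumeCompatible :
    ¬ ∀ (F : Type) [NontriviallyNormedField F] [IsUltrametricDist F] [ProperSpace F] [MeasurableSpace F]
        [BorelSpace F] (log : F → F), LogVolumeCompatible log := by
  intro h
  borelize ℚ_[2]
  obtain ⟨log, hlog⟩ := exists_not_logVolumeCompatible (K := ℚ_[2])
  exact hlog (h ℚ_[2] log)

/-- **FACT-LIST F-0160, universal closure REFUTED** (witness `K = ℚ_[2]`, the junk structure with `p* = 4`).
[cite: MochizukiAbsTopIII2015, Cor 5.10 (i) p. 147] -/
theorem not_forall_logShellFiniteVolume :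
    ¬ ∀ (F : Type) [NontriviallyNormedField F] [IsUltrametricDist F] [ProperSpace F] [MeasurableSpace F]
        [BorelSpace F] (L : PadicLogOnUnits F), LogShellFiniteVolume L := by
  intro h
  borelize ℚ_[2]
  obtain ⟨L, hL⟩ := exists_not_logShellFiniteVolume (K := ℚ_[2])
  exact hL (h ℚ_[2] L)

/-- **FACT-LIST F-0161, universal closure REFUTED** (witness: the one-place family `v ↦ ℚ_[2]`, `log_v := (2·)`,
any archimedean flag). [cite: MochizukiAbsTopIII2015, Cor 5.10 (ii) p. 147] -/
theorem not_forall_logVolumesLogCompatible :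
    ¬ ∀ (Vnon : Type) (F : Vnon → Type) [∀ v, NontriviallyNormedField (F v)] [∀ v, IsUltrametricDist (F v)]
        [∀ v, ProperSpace (F v)] [∀ v, MeasurableSpace (F v)] [∀ v, BorelSpace (F v)]
        (log : ∀ v, F v → F v) (hasArc : Prop), LogVolumesLogCompatible F log hasArc := by
  intro h
  borelize ℚ_[2]
  obtain ⟨log, hlog⟩ := exists_not_logVolumesLogCompatible (K := ℚ_[2]) True
  exact hlog (h Unit (fun _ => ℚ_[2]) log True)

end Literature.AnabelianGeometry.AbsoluteAnabelian

end
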